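import Mathlib.Geometry.Manifold.Instances.Sphere
import Mathlib.Geometry.Manifold.Diffeomorph
import Mathlib.Geometry.Manifold.PoincareConjecture
import Literature.Topology.FourManifolds.DehnSurgery
import Literature.Topology.FourManifolds.GluckTwist
import Literature.Topology.FourManifolds.Knots
import Literature.Topology.FourManifolds.SmoothOrientation
import Literature.Topology.FourManifolds.Isotopy
import HarnessLib
import HarnessLib.Audit

-- D-0014 sorry-sweep (operator, 2026-08-13): sorried theorems -> named facts `def X : Prop`; partial proofs preserved in comments
-- provenance: harness21/H21/H21/Statements/SPC4/SurgeryGluck.lean @ 12c92f1 (interim HEAD d8f2665); M5 mechanical rewrite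
-- verdict clean-up (literature-prover-defact-Topology-FourManifolds-SurgeryGluck-6e523c42-0, 2026-08-15):
-- `GluckTwistConjecture` re-read against Kirby Problem 4.24 (Contemp. Math. 35 (1984) pp. 513–528 and the
-- 1997 list), Aitchison–Rubinstein "CONJECTURE (Gluck)" (Contemp. Math. 35, §4) and Gabai–Naylor–Schwartz
-- (Adv. Math. 480 (2025), §1, §2.1) and registered as an OPEN statement (docstring `OPEN CONJECTURE — …
-- [status: open]`; name and statement unchanged — it has users, see the module docstring "Registry").
/-!
# SPC4 — Gluck twists, Lickorish–Wallace and Property R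

Family `spc4` of the H21 statement library (trunk `FourManM`, outline
`H21/Outlines/FourManM.md` §3, file `Statements/SPC4/SurgeryGluck.lean`): the target statements
about 4-manifolds and 3-manifolds obtained by *regluing* — the Gluck twist `Σ_K` of a 2-knot
`K ⊆ S⁴` and integral Dehn surgery on framed knots and links in `S³` — that the relational gluing
predicates `Literature.Topology.FourManifolds.IsGluckTwist` (`Prelude/FourManM/GluckTwist.lean`) and `Literature.Topology.FourManifolds.IsIntegralSurgery`,
`Literature.Topology.FourManifolds.IsIntegralSurgeryLink` (`Prelude/FourManM/DehnSurgery.lean`) make statable.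

## Covered statement ids

* `spc4.S19` `GluckTwistConjecture` — a registered **OPEN CONJECTURE** `[status: open]`, not a
  named fact awaiting discharge (Gluck 1962 §17; Kirby Problem 4.24; see "Registry" below): every
  Gluck twist of a smooth 2-knot in `S⁴` is diffeomorphic to `S⁴`; plus the known part
  `nonempty_homeomorph_sphere_four_of_isGluckTwist` (`Σ_K ≃ₜ S⁴`, Gluck 1962 §17 + Freedman 1982),
  restated from the prelude; and the proved reductions `GluckTwistConjecture.of_nonemptyDiffeomorphSphere`
  (SPC4 + the homeomorphism fact ⇒ the conjecture) and
  `nonempty_diffeomorph_sphere_four_of_isGluckTwist_of_isUnknot_of` (unknotted case from the two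
  prelude Gluck facts), see the last section.
* `spc4.S22` Lickorish–Wallace (`exists_isIntegralSurgeryLink`): every closed connected orientable
  smooth 3-manifold is integral surgery on a framed link in `S³` (Lickorish, Ann. of Math. 76
  (1962); Wallace, Canad. J. Math. 12 (1960)).
* `spc4.S25` Property R (`isUnknot_of_isIntegralSurgery_zero`): if `0`-surgery on `K` is
  `S² × S¹` then `K` is the unknot (Gabai, J. Diff. Geom. 26 (1987), Cor. 8.3).

## Registry: `GluckTwistConjecture` is an OPEN statement (verdict clean-up 2026-08-15)

`GluckTwistConjecture` was seated as a named fact and its tenured prove-seat returned the verdict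
*open problem*. Re-verified against held/fetched sources: H. Gluck, Trans. AMS 104 (1962) §17 poses
the question (the Gluck twist `Σ_K` is a homotopy 4-sphere — is it `S⁴`?); I. R. Aitchison and
J. H. Rubinstein, *Fibered knots and involutions on homotopy spheres*, in Gordon–Kirby (eds.),
Contemp. Math. 35 (1984) 1–74, §4, print it as "CONJECTURE (Gluck)"; R. Kirby's problem list,
Problem 4.24 (Gluck): "Question: Must it be `S⁴`?" — 1984 list (Contemp. Math. 35, 513–528): "This
problem is open in the smooth case"; 1997 list, Update: "Yes topologically, but the question is
still wide open in the smooth case"; R. Kirby, *The Topology of 4-Manifolds*, LNM 1374 (1989) Ch. I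
§6: "not known to be diffeomorphic to `S⁴` except in a few cases"; D. Gabai, P. Naylor,
H. Schwartz, Adv. Math. 480 (2025) 110455, §1 and §2.1: "it has remained an open question whether
all Gluck twists on spheres in `S⁴` are standard". The tree agrees: no `GluckTwistConjecture_holds`
and no `not_GluckTwistConjecture` exist, and `¬ GluckTwistConjecture.{0}` is the live thesis of the
route `Summits/SmoothPoincare4/SmoothPoincare4/Theses/GluckLasagna.lean` (conjunct
`GlasGluckTwistConjecture`). Treatment (CONVENTIONS §4: open conjectures are `def …Conjecture : Prop`,
never asserted): the statement and the name are **unchanged** (the name already carries the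
`Conjecture` suffix and has users in `GluckTwistFreedman.lean`, `GluckTwistFreedmanSmooth.lean`,
`SurgeryGluckProofs.lean`, `SurgeryGluckIrreducible.lean`, `Literature/Barriers/SmoothPoincare4/
GluckTwistsDissolve.lean` and the two SPC4 theses `GluckLasagna`, `PIC`); only its docstring now
opens `OPEN CONJECTURE —`, cites where the conjecture is posed and carries `[status: open]`, so the
`def` is a registered open statement and not literature debt. Users keep taking
`(h : GluckTwistConjecture)`; what is provable about it is in the last section of this file.

## Deliberately not stated

* Property 2R and the generalised Property R conjecture (Gompf–Scharlemann–Thompson, Geom. Topol.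
  14 (2010); Kirby list 1.82): "if surgery on an `n`-component framed link `L` gives
  `#ⁿ (S¹ × S²)` then `L` is handle-slide equivalent to the `0`-framed unlink". This needs handle
  slides / Kirby calculus on framed links (notion `kirby_calculus_handles`, tier L), which the
  prelude does not provide; it is recorded here and in the docstring of
  `isUnknot_of_isIntegralSurgery_zero` only.
* The Kirby calculus uniqueness half of Lickorish–Wallace (Kirby 1978: two framed links give
  diffeomorphic 3-manifolds iff related by blow-ups and handle slides), for the same reason.
* Cappell–Shaneson / circle surgery statements (`spc4.S18`), which need a third gluing predicate.

## Mathlib status and design choices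

* Mathlib has the spheres `𝕊 n` and their products as smooth manifolds
  (`Mathlib.Geometry.Manifold.Instances.Sphere`), diffeomorphisms `≃ₘ⟮_, _⟯`, homeomorphisms
  `≃ₜ`, and the smooth Poincaré statement `ContinuousMap.HomotopyEquiv.NonemptyDiffeomorphSphere`
  (`Mathlib.Geometry.Manifold.PoincareConjecture`); it has no Gluck twist, Dehn surgery, framings,
  knots or orientability of manifolds (searched `Gluck`, `Dehn`, `surgery`, `framing`,
  `Orientable`): those come from the H21 prelude (`Literature.Topology.FourManifolds.IsGluckTwist`, `Literature.Topology.FourManifolds.IsIntegralSurgery`,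
  `Literature.Topology.FourManifolds.IsIntegralSurgeryLink`, `Literature.Topology.FourManifolds.Knot`, `Literature.Topology.FourManifolds.TwoKnot`, `Literature.Topology.FourManifolds.Link`, `Literature.Topology.FourManifolds.Knot.IsUnknot`,
  `Literature.Topology.FourManifolds.IsOrientable`). Nothing new is *defined* here except the `Prop` `GluckTwistConjecture`.
* `namespace Literature.SPC4`, local notations `𝔼 n`, `𝕊 n` exactly as in `Wave0.lean`; manifolds are
  `[TopologicalSpace M] [T2Space M] [SecondCountableTopology M] [ChartedSpace (𝔼 n) M]`
  (`+ [IsManifold (𝓡 n) ∞ M]` for DIFF, `+ [CompactSpace M]` for closed); universal statements are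
  universe-polymorphic.
* In `GluckTwistConjecture` compactness of `X` is *not* assumed: it follows from
  `IsGluckTwist` (`Literature.Topology.FourManifolds.IsGluckTwist.compactSpace`), exactly as in the prelude theorem
  `Literature.Topology.FourManifolds.nonempty_homeomorph_sphere_of_isGluckTwist`.
* In Property R the model `S² × S¹` is Mathlib's product manifold `↥(𝕊 2) × ↥(𝕊 1)` with model
  `(𝓡 2).prod (𝓡 1)`, matching the prelude sanity theorem `Literature.Topology.FourManifolds.isIntegralSurgery_unknot_zero`
  (`0`-surgery on the unknot *is* `S² × S¹`), so the statement is not vacuous. The framing sign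
  convention of `Knot.TubularNbhd.det_pos` is irrelevant since `m = 0`.
* Lickorish–Wallace takes orientability as the hypothesis `IsOrientable (𝓡 3) Y` (existence of a
  `SmoothOrientation`, `Prelude/FourManM/SmoothOrientation.lean`); no orientation *datum* is
  needed since the conclusion is about the unoriented diffeomorphism type (surgery presentations of
  `Y` and `-Y` differ by mirroring the link and negating the framings).

Sources: H. Gluck, Trans. AMS 104 (1962) §§8, 17; C. McA. Gordon, Comment. Math. Helv. 51 (1976);
R. Kirby, *Problems in low-dimensional topology* (1997), 1.82, 4.24; M. Freedman, J. Diff. Geom. 17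
(1982) Thm 1.6; W. B. R. Lickorish, Ann. of Math. 76 (1962) 531–540; A. H. Wallace, Canad. J.
Math. 12 (1960) 503–528; D. Gabai, *Foliations and the topology of 3-manifolds III*, J. Diff.
Geom. 26 (1987) 479–536, Cor. 8.3; R. Gompf, M. Scharlemann, A. Thompson, Geom. Topol. 14 (2010);
D. Rolfsen, *Knots and Links* (1976) §9.I; R. Gompf, A. Stipsicz, *4-Manifolds and Kirby Calculus*
(1999) §5.3, §6.2.
-/

open scoped Manifold ContDiff Topology
open Function Set

noncomputable section

namespace Literature.Topology.FourManifolds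

universe u

/-- Local notation: `𝔼 n` is the model Euclidean space `EuclideanSpace ℝ (Fin n)`. -/
local notation "𝔼 " n:arg => EuclideanSpace ℝ (Fin n)

/-- Local notation: `𝕊 n` is the unit sphere in `EuclideanSpace ℝ (Fin (n + 1))`, the standard
`n`-sphere with its Mathlib manifold structure. -/
local notation "𝕊 " n:arg => (Metric.sphere (0 : EuclideanSpace ℝ (Fin (n + 1))) 1)

/-! ### spc4.S19: the Gluck twist conjecture -/

/-- OPEN CONJECTURE — **the Gluck twist conjecture** (`spc4.S19`), posed as a question by H. Gluck,
*The embedding of two-spheres in the four-sphere*, Trans. AMS 104 (1962) 308–333, §17 (the Gluck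
twist `Σ_K` of a 2-knot `K ⊆ S⁴` is a homotopy 4-sphere; is it `S⁴`?), printed as
"CONJECTURE (Gluck)" by Aitchison–Rubinstein in Gordon–Kirby (eds.), *Four-Manifold Theory*,
Contemp. Math. 35 (1984) 1–74, §4, and listed as R. Kirby's Problem 4.24 (Gluck) — "Question: Must
it be `S⁴`?"; 1984 list (Contemp. Math. 35, 513–528): "open in the smooth case"; 1997 list,
Update: "Yes topologically, but the question is still wide open in the smooth case" — and still
open per Gabai–Naylor–Schwartz, Adv. Math. 480 (2025) 110455, §2.1 ("it has remained an open
question whether all Gluck twists on spheres in `S⁴` are standard") [status: open]. A registered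
open statement (CONVENTIONS §4), not a named fact awaiting discharge: no
`GluckTwistConjecture_holds` can be vendored; users take `(h : GluckTwistConjecture)`, and its
negation is a live route thesis towards an exotic `S⁴`.

Statement: every Gluck twist of a smooth 2-knot in `S⁴` is diffeomorphic to `S⁴` — for every
2-knot `K : 𝕊 2 ↪ 𝕊 4` and every (Hausdorff, second countable) smooth 4-manifold `X` which is a
Gluck twist of `𝕊 4` along `K` (`Literature.Topology.FourManifolds.IsGluckTwist`:
`X ≅ (S⁴ ∖ νK) ∪_τ (S² × D²)`, `τ` the regluing of `S² × S¹` by the non-trivial element of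
`π₁(SO(3)) ≅ ℤ/2`), `X` is diffeomorphic to `𝕊 4`. Such an `X` is automatically compact
(`Literature.Topology.FourManifolds.IsGluckTwist.compactSpace`) and homeomorphic to `𝕊 4`
(`nonempty_homeomorph_sphere_four_of_isGluckTwist`: Gluck 1962 §17 + Freedman 1982), so the
conjecture is a special case of the smooth 4-dimensional Poincaré conjecture `spc4.S01`
(`GluckTwistConjecture.of_nonemptyDiffeomorphSphere` below). Known cases (not formalised here;
list of Gabai–Naylor–Schwartz 2025 §2.1 and Kirby 4.24 Remarks): spun and, more generally, ribbon
2-knots (Gluck 1962); twist-spun knots (C. Gordon, Comment. Math. Helv. 51 (1976); Pao 1978);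
2-knots `0`-cobordant to 2-knots with standard Gluck twist (Melvin 1977); certain satellites
(Șeu 2020); doubles `Σ_{S # -S}` with `S` a union of two ribbon discs one of which has undisking
number one (Gabai–Naylor–Schwartz 2025, main theorem); the unknotted case is
`nonempty_diffeomorph_sphere_four_of_isGluckTwist_of_isUnknot_of` below.
[cite: GluckTAMS1962, §17 (the question); KirbyProblems1997, Problem 4.24; GabaiNaylorSchwartz2025, §2.1 (status)] -/
@[conjecture] def GluckTwistConjecture : Prop :=
  ∀ (K : TwoKnot) (X : Type u) [TopologicalSpace X] [T2Space X] [SecondCountableTopology X]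
    [ChartedSpace (𝔼 4) X] [IsManifold (𝓡 4) ∞ X],
    IsGluckTwist (𝓡 4) X K → Nonempty (X ≃ₘ⟮𝓡 4, 𝓡 4⟯ (𝕊 4))

/-- **spc4.S19** (known part: a Gluck twist is homeomorphic to `S⁴`; H. Gluck, Trans. AMS 104
(1962) §17: `Σ_K` is a simply connected closed smooth 4-manifold with the homology of `S⁴`, i.e. a
homotopy 4-sphere; M. Freedman, J. Diff. Geom. 17 (1982) Thm 1.6: homotopy 4-spheres are
homeomorphic to `S⁴`). Restated from the prelude theorem
`Literature.Topology.FourManifolds.nonempty_homeomorph_sphere_of_isGluckTwist`.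
[cite: GluckTAMS1962, §17; FreedmanJDG1982 Thm. 1.6] -/
def nonempty_homeomorph_sphere_four_of_isGluckTwist : Prop :=
  ∀ {K : TwoKnot} {X : Type u} [TopologicalSpace X] [T2Space X] [SecondCountableTopology X] [ChartedSpace (𝔼 4) X] [IsManifold (𝓡 4) ∞ X] (h : IsGluckTwist (𝓡 4) X K),
    Nonempty (X ≃ₜ (𝕊 4))

/-- `nonempty_homeomorph_sphere_four_of_isGluckTwist` is the prelude named fact
`Literature.Topology.FourManifolds.nonempty_homeomorph_sphere_of_isGluckTwist`. [cite: GluckTAMS1962, §17; FreedmanJDG1982 Thm. 1.6] -/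
theorem nonempty_homeomorph_sphere_four_of_isGluckTwist_of
    (H : ∀ K : TwoKnot, Literature.Topology.FourManifolds.nonempty_homeomorph_sphere_of_isGluckTwist.{u} (K := K)) :
    nonempty_homeomorph_sphere_four_of_isGluckTwist.{u} :=
  fun h => H _ h

variable [SphereEmbedding.SmoothnessFacts] in
/-- The Gluck twist conjecture holds for the unknotted 2-sphere: a Gluck twist of `𝕊 4` along a
2-knot isotopic to `unknotTwo` is diffeomorphic to `𝕊 4`, since `𝕊 4` itself is such a Gluck
twist (`Literature.Topology.FourManifolds.isGluckTwist_sphere_unknotTwo`) and the Gluck twist depends only on the isotopy class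
of the 2-knot (`Literature.Topology.FourManifolds.nonempty_diffeomorph_of_isGluckTwist`). Gluck, Trans. AMS 104 (1962) §17;
Gompf–Stipsicz, Ex. 6.2.2 (a). (Hausdorffness and second countability of `X` are not assumed: they
are not needed by `Literature.Topology.FourManifolds.nonempty_diffeomorph_of_isGluckTwist`.)
[cite: GluckTAMS1962, §17; GompfStipsiczGSM1999 Ex. 6.2.2(a)] -/
def nonempty_diffeomorph_sphere_four_of_isGluckTwist_of_isUnknot : Prop :=
  ∀ {K : TwoKnot} {X : Type u} [TopologicalSpace X] [ChartedSpace (𝔼 4) X] [IsManifold (𝓡 4) ∞ X] (h : IsGluckTwist (𝓡 4) X K) (hK : K.IsUnknot),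
    Nonempty (X ≃ₘ⟮𝓡 4, 𝓡 4⟯ (𝕊 4))

/- interim proof relied on results that are now named facts (D-0014); demoted to a fact by the D-0014 sorry-sweep, proof preserved:
:=
  Literature.nonempty_diffeomorph_of_isGluckTwist h isGluckTwist_sphere_unknotTwo hK
-/

/-! ### spc4.S22: the Lickorish–Wallace theorem -/

/-- **spc4.S22** (Lickorish–Wallace theorem; W. B. R. Lickorish, *A representation of orientable
combinatorial 3-manifolds*, Ann. of Math. 76 (1962) 531–540, Thm 2; A. H. Wallace, *Modifications
and cobounding manifolds*, Canad. J. Math. 12 (1960) 503–528; Rolfsen, *Knots and Links* §9.I;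
Gompf–Stipsicz Thm 5.3.2). Every closed (compact, boundaryless), connected, orientable smooth
3-manifold `Y` is obtained by integral Dehn surgery on a framed link in `S³`: there are `k`,
a `k`-component link `L` in `𝕊 3` and framings `m : Fin k → ℤ` such that
`Literature.IsIntegralSurgeryLink (𝓡 3) Y L m` (one may even take all `m i = ±1`, Lickorish). For
`Y = 𝕊 3` take the empty link (`k = 0`) or `±1`-surgery on the unknot
(`Literature.isIntegralSurgery_unknot_one`). [cite: LickorishAnnals1962, Thm. 2; WallaceCJM1960] -/
def exists_isIntegralSurgeryLink : Prop :=
  ∀ (Y : Type u) [TopologicalSpace Y] [T2Space Y] [SecondCountableTopology Y] [ChartedSpace (𝔼 3) Y] [IsManifold (𝓡 3) ∞ Y] [CompactSpace Y] [ConnectedSpace Y] (hY : IsOrientable (𝓡 3) Y),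
    ∃ (k : ℕ) (L : Link (Fin k)) (m : Fin k → ℤ), IsIntegralSurgeryLink (𝓡 3) Y L m

/-! ### spc4.S25: Property R -/

variable [SphereEmbedding.SmoothnessFacts] in
/-- **spc4.S25** (Property R; D. Gabai, *Foliations and the topology of 3-manifolds III*, J. Diff.
Geom. 26 (1987) 479–536, Cor. 8.3; Kirby list (1997) Problem 1.82). If `0`-surgery on a knot
`K ⊆ S³` is (diffeomorphic to) `S² × S¹` — here: the product manifold `↥(𝕊 2) × ↥(𝕊 1)` with
model `(𝓡 2).prod (𝓡 1)` *is* a `0`-surgery on `K` in the sense of `Literature.Topology.FourManifolds.IsIntegralSurgery` — then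
`K` is the unknot (`Literature.Topology.FourManifolds.Knot.IsUnknot`: isotopic to `Literature.Topology.FourManifolds.unknot`). The converse is the prelude
theorem `Literature.Topology.FourManifolds.isIntegralSurgery_unknot_zero`; since `IsIntegralSurgery` is an open-gluing
predicate transported along diffeomorphisms, the hypothesis says exactly "the `0`-surgery on `K`
is diffeomorphic to `S² × S¹`" (uniqueness of surgery,
`Literature.Topology.FourManifolds.nonempty_diffeomorph_of_isIntegralSurgery`). The framing sign convention
(`Knot.TubularNbhd.det_pos`) is irrelevant since `m = 0`.
**Not stated:** Property 2R and the generalised Property R conjecture (Gompf–Scharlemann–Thompson,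
Geom. Topol. 14 (2010); Kirby 1.82: if surgery on an `n`-component framed link yields
`#ⁿ (S¹ × S²)` then the link is handle-slide equivalent to the `0`-framed unlink), which need
handle slides on framed links (notion `kirby_calculus_handles`, tier L).
[cite: GabaiJDG1987, Cor. 8.3] -/
def isUnknot_of_isIntegralSurgery_zero : Prop :=
  ∀ (K : Knot) (h : IsIntegralSurgery ((𝓡 2).prod (𝓡 1)) ((𝕊 2) × (𝕊 1)) K 0),
    K.IsUnknot

variable [SphereEmbedding.SmoothnessFacts] in
/-- Property R, converse direction packaged as an `iff`: `S² × S¹` is `0`-surgery on `K` if and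
only if `K` is the unknot (`←`: `Literature.Topology.FourManifolds.isIntegralSurgery_unknot_zero` transported along the isotopy
by `Literature.Topology.FourManifolds.IsIntegralSurgery.of_isIsotopic`; `→`: Gabai's Property R). Gabai, J. Diff. Geom. 26
(1987), Cor. 8.3; Rolfsen (1976), §9.G Example 3.
[cite: GabaiJDG1987, Cor. 8.3; RolfsenKnotsLinks1976 §9.G Example 3] -/
def isIntegralSurgery_sphereTwo_prod_zero_iff : Prop :=
  ∀ (K : Knot),
    IsIntegralSurgery ((𝓡 2).prod (𝓡 1)) ((𝕊 2) × (𝕊 1)) K 0 ↔ K.IsUnknot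

/- interim proof relied on results that are now named facts (D-0014); demoted to a fact by the D-0014 sorry-sweep, proof preserved:
:=
  ⟨isUnknot_of_isIntegralSurgery_zero K,
    fun hK ↦ isIntegralSurgery_unknot_zero.of_isIsotopic hK.symm⟩
-/

/-! ### spc4.S19: proved reductions (status of `GluckTwistConjecture`)

`GluckTwistConjecture` is an **open problem**, not a published theorem: Gluck, Trans. AMS 104
(1962) §17 *asks* whether `Σ_K ≅ S⁴`; it is stated as "CONJECTURE (Gluck)" in Gordon–Kirby (eds.),
*Four-Manifold Theory*, Contemp. Math. 35 (1984), p. 32, listed as Kirby Problem 4.24, and reported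
open in *Doubles of Gluck twists: a five-dimensional approach*, Adv. Math. (2025),
doi:10.1016/j.aim.2025.110455, arXiv:2307.06388, §1 and §2.1 ("it has remained an open question
whether all Gluck twists on spheres in `S⁴` are standard"). No `GluckTwistConjecture_holds` can be vendored. What *is* provable is recorded below:
the conjecture follows from the smooth 4-dimensional Poincaré conjecture (given the Gluck–Freedman
homeomorphism fact), and it holds for unknotted 2-spheres (given the two prelude Gluck facts). -/

/-- **The Gluck twist conjecture is a special case of SPC4.** If every Hausdorff, second countable
smooth 4-manifold homotopy equivalent to `S⁴` is diffeomorphic to `S⁴` — Mathlib's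
`ContinuousMap.HomotopyEquiv.NonemptyDiffeomorphSphere M 4` closed over all such `M : Type u`,
which is *verbatim* the body of `Literature.SPC4.SmoothPoincareConjectureFour.{u}`
(`Summits/SmoothPoincare4/SmoothPoincare4/Statement.lean`) — and every Gluck twist is homeomorphic
to `S⁴` (`nonempty_homeomorph_sphere_four_of_isGluckTwist`: Gluck 1962 §17 + Freedman 1982
Thm 1.6), then every Gluck twist is diffeomorphic to `S⁴`. Proof: a homeomorphism is a homotopy
equivalence (`Homeomorph.toHomotopyEquiv`). Gordon–Kirby (1984) p. 37: a non-standard Gluck twist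
"would then [be] a counterexample to Gluck's conjecture" and to SPC4.
[cite: GluckTAMS1962, §17; FreedmanJDG1982 Thm. 1.6] -/
theorem GluckTwistConjecture.of_nonemptyDiffeomorphSphere
    (hSPC4 : ∀ (M : Type u) [TopologicalSpace M] [T2Space M] [SecondCountableTopology M],
      ContinuousMap.HomotopyEquiv.NonemptyDiffeomorphSphere M 4)
    (hHomeo : nonempty_homeomorph_sphere_four_of_isGluckTwist.{u}) :
    GluckTwistConjecture.{u} := by
  intro K X _ _ _ _ _ hX
  obtain ⟨e⟩ := hHomeo hX
  exact hSPC4 X ‹_› ‹_› e.toHomotopyEquiv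

/-- The same reduction with the homeomorphism hypothesis in its prelude form
`Literature.Topology.FourManifolds.nonempty_homeomorph_sphere_of_isGluckTwist` (one instance per 2-knot).
[cite: GluckTAMS1962, §17; FreedmanJDG1982 Thm. 1.6] -/
theorem GluckTwistConjecture.of_nonemptyDiffeomorphSphere'
    (hSPC4 : ∀ (M : Type u) [TopologicalSpace M] [T2Space M] [SecondCountableTopology M],
      ContinuousMap.HomotopyEquiv.NonemptyDiffeomorphSphere M 4)
    (hHomeo : ∀ K : TwoKnot, Literature.Topology.FourManifolds.nonempty_homeomorph_sphere_of_isGluckTwist.{u} (K := K)) :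
    GluckTwistConjecture.{u} :=
  GluckTwistConjecture.of_nonemptyDiffeomorphSphere hSPC4
    (nonempty_homeomorph_sphere_four_of_isGluckTwist_of hHomeo)

/-- Conversely, `GluckTwistConjecture` specialises to each 2-knot: under the conjecture, any Gluck
twist `X` of `S⁴` along `K` is diffeomorphic to `𝕊 4` (pointwise form, convenient for users holding
`(h : GluckTwistConjecture)`). [cite: GluckTAMS1962, §17 (the question)] -/
theorem GluckTwistConjecture.nonempty_diffeomorph (hG : GluckTwistConjecture.{u}) {K : TwoKnot}
    {X : Type u} [TopologicalSpace X] [T2Space X] [SecondCountableTopology X]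
    [ChartedSpace (𝔼 4) X] [IsManifold (𝓡 4) ∞ X] (hX : IsGluckTwist (𝓡 4) X K) :
    Nonempty (X ≃ₘ⟮𝓡 4, 𝓡 4⟯ (𝕊 4)) :=
  hG K X hX

variable [SphereEmbedding.SmoothnessFacts] in
/-- **The Gluck twist conjecture holds for the unknotted 2-sphere**, discharged from the two
prelude Gluck facts it was demoted with (D-0014): well-definedness of the Gluck twist on isotopy
classes (`Literature.Topology.FourManifolds.nonempty_diffeomorph_of_isGluckTwist`, Gluck 1962 §8) and `Σ_{unknot} = S⁴`
(`Literature.Topology.FourManifolds.isGluckTwist_sphere_unknotTwo`, Gluck 1962 §17; Gompf–Stipsicz Ex. 6.2.2 (a)). This is the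
interim proof preserved in the comment after
`nonempty_diffeomorph_sphere_four_of_isGluckTwist_of_isUnknot`, with its two uses of then-sorried
theorems turned into hypotheses.
[cite: GluckTAMS1962, §§8, 17; GompfStipsiczGSM1999 Ex. 6.2.2(a)] -/
theorem nonempty_diffeomorph_sphere_four_of_isGluckTwist_of_isUnknot_of
    (hWD : ∀ {X : Type u} [TopologicalSpace X] [ChartedSpace (𝔼 4) X] {K : TwoKnot},
      Literature.Topology.FourManifolds.nonempty_diffeomorph_of_isGluckTwist (IX := 𝓡 4) (IX' := 𝓡 4) (X := X) (X' := ↥(𝕊 4))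
        (K := K) (K' := unknotTwo))
    (hU : Literature.Topology.FourManifolds.isGluckTwist_sphere_unknotTwo) :
    nonempty_diffeomorph_sphere_four_of_isGluckTwist_of_isUnknot.{u} :=
  fun h hK => hWD h hU hK

end Literature.Topology.FourManifolds
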